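import Literature.AlgebraicGeometry.HodgeTheory.WeilClassesDescending
import Literature.AlgebraicGeometry.HodgeTheory.WeilClassesSurfacesProofs
import Literature.AlgebraicGeometry.HodgeTheory.AbelianVarietyEndomorphismsHOne
import Literature.AlgebraicGeometry.Motives.AbelianVarietyProjectiveChart
import Literature.AlgebraicGeometry.Motives.AimedSplitProduct
import Literature.AlgebraicGeometry.HodgeTheory.WeilClassesTestEigenspaces
import HarnessLib

/-!
# Towards `exists_weilTypeSurface_prod_isHyperbolicWeilType_all`: the partner surface (proved steps)

Sibling of `WeilClassesDescending` (the named fact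
`exists_weilTypeSurface_prod_isHyperbolicWeilType_all`: Markman, arXiv:2509.23403 §11.5 Step 2 in
every even dimension — for a Weil-type `2n`-fold `(A₁, φ₁)` there is a Weil SURFACE `(A₂, φ₂)` such
that `(A₁ × A₂, φ₁ × φ₂)` is of hyperbolic Weil type for the `K`-symmetrised hyperplane class of
some projective embedding; van Geemen LNM 1594, Lemma 5.2, 5.3–5.8, 5.4 (5.4.1); Landherr). The
printed proof has a SURFACE half ("there exists a polarized abelian surface of Weil type
`(A₂, η₂, h₂)`") and an AIMING half (discriminants multiply, every class is a discriminant, Landherr).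
This file PROVES the surface half in the exact typing of the fact's conclusion, for every `d ≥ 1`:

* `eq_conjClass_of_isRationalClass_add` — for `n, d ≥ 1`, if `u₊ ∈ E₊`, `u₋ ∈ E₋`
  (`weilClassesPlus/Minus A φ n d`) and `u₊ + u₋` is rational, then `u₋ = conj u₊`: rational classes
  are real, conjugation swaps the two Weil lines (`conjClass_mem_weilClassesMinus/Plus`, van Geemen,
  proof of Lemma 5.2 (6): `W'₊`, `W'₋` are complex conjugate) and `E₊ ⊓ E₋ = 0`;
* `ne_zero_of_isRationalClass_add` — hence a NON-ZERO rational Weil class has BOTH eigen-components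
  non-zero (the shape "`u₊ ≠ 0 ∧ u₋ ≠ 0`" in which the descending facts
  `exists_weilTypeSurface_prod_isHyperbolicWeilType_all`, `Schoen1998_weilClasses_algebraic_of_prod_surface_all`
  render "`A₂` is of Weil type");
* `exists_weilTypeSurface_partner` — **for every `d ≥ 1` there is a smooth projective complex abelian
  surface `(A₂, φ₂)` with `φ₂ ≫ φ₂ = -(d • 𝟙 A₂)` and classes `u₊ ∈ E₊`, `u₋ ∈ E₋` with `u₊ + u₋`
  rational of Hodge type `(1,1)` and `u₊ ≠ 0`, `u₋ ≠ 0`** — the first five conjuncts of the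
  conclusion of `exists_weilTypeSurface_prod_isHyperbolicWeilType_all`, from the tree's THEOREM
  `exists_weilType_abelianSurfaces_holds` (`B = E_i × E_i` with the companion endomorphism
  `ψ = ((0,-d),(1,0))`, file `WeilClassesSurfacesProofs`) and `AbelianVariety.isSmoothProjective_holds`.

Not here (the aiming half, see the module docstring of `Motives/AimedSplitProduct` "Why it is not
proved here" and this unit's notes): the signature `(n, n)` of the Hermitian form of a hyperplane
class on a Weil-type `A₁` (Hodge–Riemann in degree one), the hyperplane class of a product
embedding on `complexBetti`, and a family of Weil surfaces realising every discriminant class.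
Everything below is proved; no definition and no named fact is introduced (D-0026).

## References

* [Markman2025SurveySecant] E. Markman, Secant sheaves and Weil classes on abelian varieties,
  arXiv:2509.23403, §11.5 Step 2.
* [vanGeemen1994HodgeAV] B. van Geemen, An introduction to the Hodge conjecture for abelian
  varieties, LNM 1594 (1994), Lemma 5.2 (6) and its proof, 5.3.
* [Schoen1998HodgeWeilAddendum] C. Schoen, Compositio Math. 114 (1998), §10 (proof of the
  Proposition, p. 333).
* [VoisinHodgeI2002] C. Voisin, Hodge Theory and Complex Algebraic Geometry I, Cor. 6.12.
-/

noncomputable section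

open CategoryTheory

namespace Literature.AlgebraicGeometry.HodgeTheory

open Literature.AlgebraicTopology.SingularHomology

section PartnerSurface

variable {A : Motives.AbelianVariety ℂ} {φ : A ⟶ A} {n d : ℕ}

/-- **The two eigen-components of a rational Weil class are complex conjugate.** For `n, d ≥ 1`,
`u₊ ∈ E₊ = weilClassesPlus A φ n d`, `u₋ ∈ E₋` with `u₊ + u₋` rational: `u₋ = conj u₊`. Indeed
`conj (u₊ + u₋) = u₊ + u₋` (rational classes are real), `conj u₊ ∈ E₋`, `conj u₋ ∈ E₊`
(`conjClass_mem_weilClassesMinus/Plus`), so `conj u₋ - u₊ = u₋ - conj u₊ ∈ E₊ ⊓ E₋ = 0`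
(`disjoint_weilClassesPlus_weilClassesMinus`). Van Geemen: the Weil lines `⋀²ⁿ W'₊`, `⋀²ⁿ W'₋` are
the eigenspaces of `(√-d)^*` on the REAL cohomology tensored with `ℂ`, hence conjugate.
[cite: vanGeemen1994HodgeAV, proof of Lemma 5.2 (6)] -/
theorem eq_conjClass_of_isRationalClass_add (hn : 0 < n) (hd : 0 < d)
    {up um : complexBetti A.X (2 * n)} (hup : up ∈ weilClassesPlus A φ n d)
    (hum : um ∈ weilClassesMinus A φ n d) (hrat : IsRationalClass (up + um)) :
    um = conjClass (Motives.ComplexPoints A.X) (2 * n) up := by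
  have hconj : conjClass (Motives.ComplexPoints A.X) (2 * n) up +
      conjClass (Motives.ComplexPoints A.X) (2 * n) um = up + um := by
    rw [← conjClass_add, hrat.conjClass_eq]
  -- `conj um - up = um - conj up`, the left side in `E₊`, the right side in `E₋`
  have hkey : conjClass (Motives.ComplexPoints A.X) (2 * n) um - up =
      um - conjClass (Motives.ComplexPoints A.X) (2 * n) up := by
    rw [sub_eq_sub_iff_add_eq_add, add_comm, hconj, add_comm]
  have hplus : conjClass (Motives.ComplexPoints A.X) (2 * n) um - up ∈ weilClassesPlus A φ n d :=
    Submodule.sub_mem _ (conjClass_mem_weilClassesPlus hum) hup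
  have hminus : um - conjClass (Motives.ComplexPoints A.X) (2 * n) up ∈ weilClassesMinus A φ n d :=
    Submodule.sub_mem _ hum (conjClass_mem_weilClassesMinus hup)
  rw [hkey] at hplus
  have h0 := (Submodule.disjoint_def.mp (disjoint_weilClassesPlus_weilClassesMinus A φ hn hd)) _
    hplus hminus
  exact (sub_eq_zero.mp h0)

/-- **Both eigen-components of a non-zero rational Weil class are non-zero.** For `n, d ≥ 1`,
`u₊ ∈ E₊`, `u₋ ∈ E₋` with `u₊ + u₋` rational and non-zero: `u₊ ≠ 0` and `u₋ ≠ 0` (by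
`eq_conjClass_of_isRationalClass_add`, `u₋ = conj u₊`, and `conj 0 = 0`). This is how the descending
facts of `WeilClassesDescending` spell "`(A₂, K)` is of Weil type `(1,1)`" on the carriers.
[cite: vanGeemen1994HodgeAV, proof of Lemma 5.2 (6)] -/
theorem ne_zero_of_isRationalClass_add (hn : 0 < n) (hd : 0 < d)
    {up um : complexBetti A.X (2 * n)} (hup : up ∈ weilClassesPlus A φ n d)
    (hum : um ∈ weilClassesMinus A φ n d) (hrat : IsRationalClass (up + um)) (h0 : up + um ≠ 0) :
    up ≠ 0 ∧ um ≠ 0 := by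
  have hum' := eq_conjClass_of_isRationalClass_add hn hd hup hum hrat
  constructor
  · rintro rfl
    rw [hum', conjClass_zero, add_zero] at h0
    exact h0 rfl
  · intro hz
    have hup0 : up = 0 := by
      have h := congrArg (conjClass (Motives.ComplexPoints A.X) (2 * n)) hum'
      rw [conjClass_conjClass, hz, conjClass_zero] at h
      exact h.symm
    rw [hup0, hz, add_zero] at h0
    exact h0 rfl

/-- **The partner surface of the product step exists, in the typing of
`exists_weilTypeSurface_prod_isHyperbolicWeilType_all` (first five conjuncts of its conclusion).**
For every `d ≥ 1` there are a complex abelian surface `A₂` (`A₂.dim = 2·1`, smooth projective of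
dimension `2·1`) and `φ₂ : A₂ ⟶ A₂` with `φ₂ ≫ φ₂ = -(d • 𝟙 A₂)`, together with `u₊ ∈ E₊`,
`u₋ ∈ E₋` (`weilClassesPlus/Minus A₂ φ₂ 1 d`) such that `u₊ + u₋` is rational of Hodge type `(1,1)`
and `u₊ ≠ 0`, `u₋ ≠ 0` — "there exists a polarized abelian surface of Weil type `(A₂, η₂, h₂)`"
(Markman §11.5 Step 2; Schoen's `A'`, §10 p. 333; van Geemen 5.3). Proof: the tree's theorem
`exists_weilType_abelianSurfaces_holds` (`E_i × E_i` with the companion endomorphism of `X² + d`)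
gives `(B, ψ)` and a non-zero rational `(1,1)`-class `b ∈ E₊ ⊔ E₋`; write `b = u₊ + u₋` and apply
`ne_zero_of_isRationalClass_add`; smooth projectivity is `AbelianVariety.isSmoothProjective_holds`.
[cite: Markman2025SurveySecant, §11.5 Step 2] [cite: Schoen1998HodgeWeilAddendum, §10 (proof of the Proposition, p. 333)]
[cite: vanGeemen1994HodgeAV, 5.3 and Lemma 5.2 (6)] -/
theorem exists_weilTypeSurface_partner (d : ℕ) (hd : 0 < d) :
    ∃ (A₂ : Motives.AbelianVariety ℂ) (φ₂ : A₂ ⟶ A₂), A₂.dim = 2 * 1 ∧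
      Motives.IsSmoothProjective (2 * 1) A₂.X ∧ φ₂ ≫ φ₂ = -(d • 𝟙 A₂) ∧
      ∃ up um : complexBetti A₂.X (2 * 1), up ∈ weilClassesPlus A₂ φ₂ 1 d ∧
        um ∈ weilClassesMinus A₂ φ₂ 1 d ∧ IsRationalClass (up + um) ∧
        IsOfHodgeType (2 * 1) A₂.X (2 * 1) 1 1 (up + um) ∧ up ≠ 0 ∧ um ≠ 0 := by
  obtain ⟨B, ψ, b, hB, hψ, hb0, hrat, h11, hW⟩ := exists_weilType_abelianSurfaces_holds d hd
  obtain ⟨up, hup, um, hum, rfl⟩ := Submodule.mem_sup.mp hW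
  have hsp : Motives.IsSmoothProjective (2 * 1) B.X := by
    have h := (Motives.AbelianVariety.isSmoothProjective_holds (A := B))
    rw [Motives.AbelianVariety.isSmoothProjective, hB] at h
    exact h
  obtain ⟨hup0, hum0⟩ := ne_zero_of_isRationalClass_add Nat.one_pos hd hup hum hrat hb0
  exact ⟨B, ψ, hB, hsp, hψ, up, um, hup, hum, hrat, h11, hup0, hum0⟩

end PartnerSurface

/-! ### The fact for `d ∉ {1, 3}` from the aiming lemma of the product trick (appended)

`Motives.exists_cmWeilSurface_aimedSplitProduct_of_ne_one_of_ne_three` (`Motives/AimedSplitProduct`,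
the corrected aiming lemma: van Geemen 5.2 (3), 5.3, 5.4 (5.4.1); Markman §11.5 Step 2; Schoen §10)
is the SAME mathematics as `exists_weilTypeSurface_prod_isHyperbolicWeilType_all` in a different
typing: "Weil type" of `(A₁, φ₁)` and of the partner surface is rendered there by ONE test
endomorphism (eigenspaces of `(𝟙 + φ)^*`), here by all of them (`weilClassesOf`, `weilClassesPlus/Minus`);
and it carries the guard `d ≠ 1, d ≠ 3` under which the two renderings agree in every dimension.
The theorem below derives the present fact, for `d ∉ {1, 3}`, from that one: a class of
`weilClassesOf A₁ φ₁ n d` is in particular a `(𝟙 + φ₁)^*`-eigen-sum (test value `(x, y) = (1, 1)`),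
and on the partner SURFACE the `(𝟙 + ψ)^*`-eigenspaces lie in the Weil lines for every `d`
(`eigenspace_le_weilClassesPlus/Minus_two`, file `WeilClassesTestEigenspaces`). What then remains of
`exists_weilTypeSurface_prod_isHyperbolicWeilType_all` beyond the aiming lemma is `d ∈ {1, 3}`
(`K = ℚ(i)`, `ℚ(√-3)`: Koike's and Schoen's original fields). -/

section OfAimed

/-- A class of the Weil plane `E₊ ⊔ E₋ = weilClassesOf A φ n d` (joint eigenclasses of ALL the test
endomorphisms `(x·𝟙 + y·φ)^*`) lies in the single-test Weil span
`Eig((𝟙 + φ)^*, (1 + i√d)²ⁿ) ⊔ Eig((𝟙 + φ)^*, (1 - i√d)²ⁿ)` (test value `(x, y) = (1, 1)`).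
[cite: vanGeemen1994HodgeAV, 4.9] -/
theorem mem_eigenspace_sup_of_mem_weilClassesOf {A : Motives.AbelianVariety ℂ} {φ : A ⟶ A} {n d : ℕ}
    {c : complexBetti A.X (2 * n)} (hc : c ∈ weilClassesOf A φ n d) :
    c ∈ Module.End.eigenspace (complexBetti.map (𝟙 A + φ).hom.hom.hom (2 * n)).hom
          ((1 + Complex.I * (Real.sqrt (d : ℝ) : ℂ)) ^ (2 * n)) ⊔
        Module.End.eigenspace (complexBetti.map (𝟙 A + φ).hom.hom.hom (2 * n)).hom
          ((1 - Complex.I * (Real.sqrt (d : ℝ) : ℂ)) ^ (2 * n)) := by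
  obtain ⟨c₁, h₁, c₂, h₂, rfl⟩ := Submodule.mem_sup.mp hc
  refine Submodule.add_mem _ (Submodule.mem_sup_left ?_) (Submodule.mem_sup_right ?_)
  · rw [Module.End.mem_eigenspace_iff, ← complexBetti_map_one_add_eq]
    have e := (mem_weilClassesPlus_iff.mp h₁) 1 1
    rw [Nat.cast_one, one_mul] at e
    exact e
  · rw [Module.End.mem_eigenspace_iff, ← complexBetti_map_one_add_eq]
    have e := (mem_weilClassesMinus_iff.mp h₂) 1 1
    rw [Nat.cast_one, one_mul] at e
    exact e

/-- **`exists_weilTypeSurface_prod_isHyperbolicWeilType_all` for `d ∉ {1, 3}` from the aiming lemma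
of the product trick.** Granted `Motives.exists_cmWeilSurface_aimedSplitProduct_of_ne_one_of_ne_three`
(the Weil SURFACE `(B, ψ)` with a descent pair `(b₊, b₋, η)` such that every Weil-type `(A, φ)` of
every even dimension has a projective embedding `e` of `A × B` and a rational `a ≠ 0` making
`(A × B, φ × ψ)` hyperbolic for `d·e^*a + (φ × ψ)^*e^*a`): for `n ≥ 1`, `d ≥ 1`, `d ≠ 1`, `d ≠ 3`
and `(A₁, φ₁)` as in the fact, take `A₂ = B`, `φ₂ = ψ`, `u± = b±` — `b₊ ∈ E₊`, `b₋ ∈ E₋` by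
`eigenspace_le_weilClassesPlus/Minus_two`, both non-zero since `b± ⌣ η ≠ 0`, `B` smooth projective by
`AbelianVariety.isSmoothProjective_holds` — and the embedding the lemma provides, the Weil witness
of `A₁` being converted by `mem_eigenspace_sup_of_mem_weilClassesOf`. The conclusion is VERBATIM that
of `exists_weilTypeSurface_prod_isHyperbolicWeilType_all` under the extra binders `d ≠ 1 → d ≠ 3 →`.
[cite: Markman2025SurveySecant, §11.5 Step 2] [cite: vanGeemen1994HodgeAV, Lemma 5.2 (3), 5.3 and 5.4 (5.4.1)]
[cite: Schoen1998HodgeWeilAddendum, §10 (proof of the Proposition)] -/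
theorem exists_weilTypeSurface_prod_isHyperbolicWeilType_all_of_aimedSplitProduct
    (haim : Motives.exists_cmWeilSurface_aimedSplitProduct_of_ne_one_of_ne_three) :
    ∀ (n : ℕ), 0 < n → ∀ (d : ℕ), 0 < d → d ≠ 1 → d ≠ 3 →
      ∀ (A₁ : Motives.AbelianVariety ℂ) (φ₁ : A₁ ⟶ A₁),
    A₁.dim = 2 * n → Motives.IsSmoothProjective (2 * n) A₁.X → φ₁ ≫ φ₁ = -(d • 𝟙 A₁) →
      (∃ c : complexBetti A₁.X (2 * n), IsRationalClass c ∧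
        IsOfHodgeType (2 * n) A₁.X (2 * n) n n c ∧ c ∈ weilClassesOf A₁ φ₁ n d ∧ c ≠ 0) →
      ∃ (A₂ : Motives.AbelianVariety ℂ) (φ₂ : A₂ ⟶ A₂), A₂.dim = 2 * 1 ∧
        Motives.IsSmoothProjective (2 * 1) A₂.X ∧ φ₂ ≫ φ₂ = -(d • 𝟙 A₂) ∧
        (∃ up um : complexBetti A₂.X (2 * 1), up ∈ weilClassesPlus A₂ φ₂ 1 d ∧
          um ∈ weilClassesMinus A₂ φ₂ 1 d ∧ IsRationalClass (up + um) ∧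
          IsOfHodgeType (2 * 1) A₂.X (2 * 1) 1 1 (up + um) ∧ up ≠ 0 ∧ um ≠ 0) ∧
        ∃ (e : Motives.ProjectiveEmbedding (A₁.prod A₂).X)
          (a : complexBetti (Motives.projectiveSpace e.n ℂ) 2), IsRationalClass a ∧ a ≠ 0 ∧
          Motives.IsHyperbolicWeilType (A₁.prod A₂)
            (Motives.AbelianVariety.prodLift (Motives.AbelianVariety.fst A₁ A₂ ≫ φ₁)
              (Motives.AbelianVariety.snd A₁ A₂ ≫ φ₂)) (n + 1)
            ((d : ℂ) • complexBetti.map e.ι 2 a +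
              complexBetti.map (Motives.AbelianVariety.prodLift
                (Motives.AbelianVariety.fst A₁ A₂ ≫ φ₁)
                (Motives.AbelianVariety.snd A₁ A₂ ≫ φ₂)).hom.hom.hom 2 (complexBetti.map e.ι 2 a)) := by
  intro n _hn d hd h1 h3 A₁ φ₁ hA₁ _hX₁ hφ₁ hc
  obtain ⟨c, hrat, hnn, hW, hc0⟩ := hc
  obtain ⟨B, ψ, hB, hψ, ⟨bp, bm, η, hbp, hbm, hbrat, hb11, _hη, hbpη, hbmη⟩, hall⟩ := haim d hd h1 h3
  have hψ' : ψ ≫ ψ = -(d • 𝟙 B) := by rw [hψ, natCast_zsmul]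
  have hφ₁' : φ₁ ≫ φ₁ = -((d : ℤ) • 𝟙 A₁) := by rw [natCast_zsmul]; exact hφ₁
  obtain ⟨e, a, ha, ha0, hhyp⟩ :=
    hall n A₁ φ₁ hA₁ hφ₁' ⟨c, hc0, hrat, hnn, mem_eigenspace_sup_of_mem_weilClassesOf hW⟩
  have hsp : Motives.IsSmoothProjective (2 * 1) B.X := by
    have h := (Motives.AbelianVariety.isSmoothProjective_holds (A := B))
    rw [Motives.AbelianVariety.isSmoothProjective, hB] at h
    exact h
  refine ⟨B, ψ, hB, hsp, hψ', ⟨bp, bm, eigenspace_le_weilClassesPlus_two hB hd hψ' hbp,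
    eigenspace_le_weilClassesMinus_two hB hd hψ' hbm, hbrat, hb11, ?_, ?_⟩, e, a, ha, ha0, hhyp⟩
  · intro h0
    apply hbpη
    rw [h0, LinearMap.map_zero₂]
  · intro h0
    apply hbmη
    rw [h0, LinearMap.map_zero₂]

end OfAimed

end Literature.AlgebraicGeometry.HodgeTheory

end
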